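import Summits.BirchSwinnertonDyer.BirchSwinnertonDyer.Theorems.ManinLocalTwoThreeLocalTwoTorsionDiscUnitIV
import Summits.BirchSwinnertonDyer.BirchSwinnertonDyer.Theorems.ManinLocalTwoThreeLocalTwoTorsionDiscUnitIVstar
import Summits.BirchSwinnertonDyer.Rank1Residual.ManinAdditive.LocalTwoTorsionDiscUnitAtTwo
import HarnessLib

/-!
# T-desc-IV♮ BY NAME: `KodairaDiscUnit.TypeFourLocalTwoTorsionCriterion`, `TypeFourStarLocalTwoTorsionCriterion`,
# `LocalTwoTorsionDiscUnitCriterionAtTwo` and the derived node `TameCellLocalTwoTorsionIffDiscUnit` HOLD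
# (cell bsd-f2-manin, descent lens MEMO-desc §33.15; typer leaf `…/ManinAdditive/LocalTwoTorsionDiscUnitAtTwo.lean` p688950 (T-desc-22);
# seat `bsd-line-manin23-p2` gen 12 — the descent planner desc g15 proved the same nodes independently in-seat, HOME/desc/g15/Proof-desc-g15d.lean
# a68b371ac86d9221, ADDENDUM 8; the by-value tree theorems used here are `LocalTwoTorsionDiscUnit.typeFourLocalTwoTorsionCriterion` /
# `typeFourStarLocalTwoTorsionCriterion` of the two sibling files)

Summit `BirchSwinnertonDyer`, route `ManinLocalTwoThree`, crux C2 `ManinOddAtFour` (stmt-BirchSwinnertonDyer-22967), tame cell `4 ∥ N`.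
CONSEQUENCE (E-blind, for -imc's FINAL erratum): the residual class R-IV′ of C2 on the tame cell («IV-optimal with a `ℚ₂`-rational
2-torsion point») is EXACTLY «`v₂(Δ_min) = 4 ∧ Δ_min/16 ≡ 5 (mod 8)`»; on `IV*` a `ℚ₂`-rational 2-torsion point exists iff
`Δ_min/2⁸ ≡ 3 (mod 4)`.  HONEST FRAMING: local statements; nothing about Manin's conjecture or BSD is proved.  No definitions, no sorry.
-/

set_option linter.dupNamespace false
set_option autoImplicit false

open Summit.BirchSwinnertonDyer.Rank1Residual.ManinAdditive.KodairaDiscUnit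

namespace Summit.BirchSwinnertonDyer.BirchSwinnertonDyer.Theorems.ManinLocalTwoThree

/-- **T-desc-IV♮(a) `KodairaDiscUnit.TypeFourLocalTwoTorsionCriterion` HOLDS** (by name; census 122/122 + OOS 173/173). [folklore] -/
theorem typeFourLocalTwoTorsionCriterion_holds : TypeFourLocalTwoTorsionCriterion :=
  fun W _ _ h4 h8 hΔ => LocalTwoTorsionDiscUnit.typeFourLocalTwoTorsionCriterion W h4 h8 hΔ

/-- **T-desc-IV♮(b) `KodairaDiscUnit.TypeFourStarLocalTwoTorsionCriterion` HOLDS** (by name; census 113/113 + OOS 102/102). [folklore] -/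
theorem typeFourStarLocalTwoTorsionCriterion_holds : TypeFourStarLocalTwoTorsionCriterion :=
  fun W _ _ h4 h8 hΔ => LocalTwoTorsionDiscUnit.typeFourStarLocalTwoTorsionCriterion W h4 h8 hΔ

/-- **T-desc-IV♮ `KodairaDiscUnit.LocalTwoTorsionDiscUnitCriterionAtTwo` HOLDS** (the conjunction; census 510/510). [folklore] -/
theorem localTwoTorsionDiscUnitCriterionAtTwo_holds : LocalTwoTorsionDiscUnitCriterionAtTwo :=
  localTwoTorsionDiscUnitCriterionAtTwo_of typeFourLocalTwoTorsionCriterion_holds typeFourStarLocalTwoTorsionCriterion_holds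

/-- **The derived node `KodairaDiscUnit.TameCellLocalTwoTorsionIffDiscUnit` HOLDS** — on `4 ∥ N` a globally minimal curve HAS a
`ℚ₂`-rational point of order `2` iff `(v₂Δ_min, unit class) ∈ {(4, 5 mod 8), (8, 3 mod 4)}` (the typer's proved edge
`tameCellLocalTwoTorsionIffDiscUnit_of` fed with T-desc-IV♮ (a)(b) above and T-desc-IV♭ (a)(b) `typeFourDiscUnitLawAtTwo_holds` /
`typeFourStarDiscUnitLawAtTwo_holds`, p684861). [folklore] -/
theorem tameCellLocalTwoTorsionIffDiscUnit_holds : TameCellLocalTwoTorsionIffDiscUnit :=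
  tameCellLocalTwoTorsionIffDiscUnit_of typeFourLocalTwoTorsionCriterion_holds typeFourStarLocalTwoTorsionCriterion_holds
    typeFourDiscUnitLawAtTwo_holds typeFourStarDiscUnitLawAtTwo_holds

end Summit.BirchSwinnertonDyer.BirchSwinnertonDyer.Theorems.ManinLocalTwoThree
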